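import Summits.BirchSwinnertonDyer.BirchSwinnertonDyer.Theorems.KolyvaginDepthDoorKolyvaginDepthSupplyDoorOfDatumPrint
import Summits.BirchSwinnertonDyer.BirchSwinnertonDyer.Theorems.KolyvaginDepthDoorKNSupplyManinFrameStructure
import Summits.BirchSwinnertonDyer.BirchSwinnertonDyer.Theorems.KolyvaginDepthDoorKNSupplyLevelOneStructure
import Literature.NumberTheory.EllipticCurves.IrreducibleModPQuadraticTwistProofs
import HarnessLib

/-!
# Route `KolyvaginDepthDoor`, crux `KolyvaginDepthSupplyKN` (stmt-BirchSwinnertonDyer-22820) —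
# THE RANK-2 SLICE AT LEVEL ONE ON THE WHOLE KODAIRA–NÉRON CELL, modulo (γ) (door) and print BY NAME
# (supply: Castella–Sano 2026 Thm. 3 ∘ Zanarella 2019 ∘ Howard–Zanarella, frame `p ∤ c_φ` from
# Mazur 1978 + Néron scaling) — the critic's price «depth table / rank-2 slice», residual curves INCLUDED

Helper file of the lead prover of line `levelone` (kdd-p1 g13; `--supports stmt-BirchSwinnertonDyer-22820
--as helper`); it closes nothing and BSD is not proved by it.

g11's slice `kolyvaginClass_one_prime_ne_zero_iff_sha_trivial_of_rank_two` (file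
`KolyvaginDepthDoorKNSupplyRankTwoSlice`) reads, per `(E, p, K)` on a rank-2 curve of W. Zhang's ♠
cell: «some frame, some Kolyvagin prime `ℓ`, some datum with `c_1(ℓ) ≠ 0`» `↔` «`Ш(E/ℚ)[p] = 0`»
(door: (γ) only; supply: W. Zhang's Lemma 8.4 (1) BY NAME, Hypothesis ♠ (2)). The three rank-2
depth-table curves `664a1`, `916c1`, `944e1` lie in the ♠ (2)-residual. This file states the SAME
equivalence on the WHOLE Kodaira–Néron cell (no ♠ (2), no square-free `N`), for `p` split in `K` and
`d_K` odd, with the supply from print BY NAME (skeleton v9's facts):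

* `exists_kolyvaginClass_one_prime_ne_zero_of_rank_two_of_sha_trivial_of_castellaSano` — supply on a
  GIVEN frame with `p ∤ Dt.c`: rank `E = 2`, `Ш(E)[p] = 0`, twist pinned ⟹ `c_1(ℓ) ≠ 0` at exactly ONE
  Kolyvagin prime, every depth-`0` class vanishes (modulo Castella–Sano Thm. 3 + Zanarella 2.18 (Selmer
  form) + Howard–Zanarella).
* `kolyvaginClass_one_prime_ne_zero_iff_sha_trivial_of_rank_two_of_maninPrint` — **THE SLICE, whole
  cell**: under `p ≥ 5` good ordinary, tower onto, Kodaira–Néron, `K` Heegner with `d_K` odd, `≠ −3, −4`,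
  `p ∤ d_K`, `p` split, `(d_K, N) = 1`, rank `E = 2`, twist pinned: «∃ frame, Kolyvagin prime `ℓ`, datum
  with `c_1(ℓ) ≠ 0`» `↔` «`Ш(E/ℚ)[p] = 0`». `→`: the KN door of a datum (g8/g9,
  `shaCorank_eq_zero_of_kolyvaginClass_ne_zero_of_rank_le_of_datum_kodairaNeron`, (γ) only); `←`: the
  supply above on the frame with `p ∤ c` of `Rank1Residual.X11b.exists_modularParametrizationData_not_dvd`
  (modularity + Mazur 1978 Cor. 4.1 + Néron scaling). The depth table's bit at EVERY rank-2 row of the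
  Kodaira–Néron cell is exactly «`Ш(E)[p] = 0`», modulo (γ) and six print facts by name.

CONDITIONAL on the named facts (all print); per curve; BSD is NOT proved by this.

References: [GrossLMS1991] Prop. 3.7 (2); [CastellaSano2026] Thm. 3; [Zanarella2019] Prop. 2.18, Cor.
2.12, 2.14; [Howard2004] Lemma 1.6.4; [Mazur1978] Cor. 4.1; [Kolyvagin1991MathAnn] Thm. 2.3;
[SilvermanAEC2009] X.4.2; [JetchevLauterStein2009] §3.6.
-/

set_option linter.dupNamespace false

noncomputable section

open scoped Classical NumberField

namespace Summit.BirchSwinnertonDyer.BirchSwinnertonDyer.Theorems.KolyvaginDepthDoor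

open Literature.NumberTheory.EllipticCurves Literature.NumberTheory.EllipticCurves.ModularForms
  WeierstrassCurve NumberField IsDedekindDomain
open Literature.NumberTheory.DiophantineGeometry (KodairaSymbol)
open Summit.BirchSwinnertonDyer.BirchSwinnertonDyer.Theorems

/-- A square-free natural number with exactly one prime factor is prime. [folklore] -/
private theorem prime_of_squarefree_of_card_primeFactors_eq_one₉ {n : ℕ} (hsq : Squarefree n)
    (h1 : n.primeFactors.card = 1) : n.Prime := by
  obtain ⟨ℓ, hℓ⟩ := Finset.card_eq_one.mp h1
  have hℓmem : ℓ ∈ n.primeFactors := by rw [hℓ]; exact Finset.mem_singleton_self ℓ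
  have hℓp : ℓ.Prime := Nat.prime_of_mem_primeFactors hℓmem
  have hprod : ∏ q ∈ n.primeFactors, q = n := Nat.prod_primeFactors_of_squarefree hsq
  rw [hℓ, Finset.prod_singleton] at hprod
  rw [← hprod]
  exact hℓp

/-- **Supply at rank 2, level one, on the whole Kodaira–Néron cell, on a frame with `p ∤ c_φ`
(modulo Castella–Sano 2026 Thm. 3 + Zanarella 2019 Prop. 2.18 (Selmer form) + Howard–Zanarella
rigidity).** `E/ℚ` globally minimal of Mordell–Weil rank `2`; `p ≥ 5` good ordinary with `ρ̄_{E,p}` and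
the tower onto and `p ∤ ord_v(Δ_min)` at multiplicative places; `K` imaginary quadratic Heegner with
`d_K` odd, `≠ −3, −4`, `p ∤ d_K`, `p` split, `(d_K, N) = 1`; twist pinned (`rank E^{(d_K)} ≤ 1`,
`Ш(E^{(d_K)})[p] = 0`); a frame `(Dt, β, ι)` with `p ∤ Dt.c`. IF `Ш(E/ℚ)[p] = 0` THEN on that frame
there are ONE Kolyvagin prime `ℓ` and a datum with `c_1(ℓ) ≠ 0`, and every depth-`0` class vanishes.
CONDITIONAL on the three named facts; BSD is not proved by it.
[cite: CastellaSano2026, Thm. 3 (arXiv:2601.14504 §1.1.6)] [cite: Zanarella2019, Prop. 2.18, Cor. 2.12, Cor. 2.14]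
[cite: Howard2004, Lemma 1.6.4] [cite: SilvermanAEC2009, Thm. X.4.2] -/
theorem exists_kolyvaginClass_one_prime_ne_zero_of_rank_two_of_sha_trivial_of_castellaSano
    (h3 : Literature.NumberTheory.EllipticCurves.CastellaSano2026_kolyvaginClass_selmerDivisibility_eq_padicValNat_tamagawaProduct)
    (hZ : Literature.NumberTheory.EllipticCurves.Zanarella2019_kolyvaginClass_one_ne_zero_of_not_selmerDivisible)
    (hHZ : Literature.NumberTheory.EllipticCurves.HowardZanarella_exists_minimal_kolyvaginClass_one_selmerCard_of_ne_zero)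
    (W : WeierstrassCurve ℚ) [W.IsElliptic] [W.IsGloballyMinimal] (hr : W.mordellWeilRank = 2)
    (p : ℕ) [hp : Fact p.Prime] (h5 : 5 ≤ p) (hgood : W.HasGoodReductionAtPrime p)
    (hord : ¬ (p : ℤ) ∣ W.frobeniusTrace p) (hsurj : W.HasSurjectiveModNGaloisRep p)
    (htower : ∀ n : ℕ, W.HasSurjectiveModNGaloisRep (p ^ n : ℕ))
    (hKN : ∀ v : HeightOneSpectrum (𝓞 ℚ), W.HasMultiplicativeReductionAt v →
      ¬ p ∣ W.ordMinimalDiscriminant v)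
    (K : Type) [Field K] [NumberField K] (hK : IsImaginaryQuadratic K)
    (hodd : Odd (NumberField.discr K)) (hD3 : NumberField.discr K ≠ -3) (hD4 : NumberField.discr K ≠ -4)
    (hpD : ¬ ((p : ℤ) ∣ NumberField.discr K)) (hspl : SatisfiesHeegnerHypothesis p K)
    (hDN : IsCoprime (NumberField.discr K) ((W.conductorNorm ℤ : ℕ) : ℤ))
    [NeZero (W.conductorNorm ℤ)] (hHeeg : SatisfiesHeegnerHypothesis (W.conductorNorm ℤ) K)
    (hT1 : (W.quadraticTwist (NumberField.discr K : ℚ)).mordellWeilRank ≤ 1)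
    (hshaT : ((W.quadraticTwist (NumberField.discr K : ℚ)).sha ⊓
        AddSubgroup.torsionBy (W.quadraticTwist (NumberField.discr K : ℚ)).galH1 (p : ℤ) :
        AddSubgroup (W.quadraticTwist (NumberField.discr K : ℚ)).galH1) = ⊥)
    (hshaW : (W.sha ⊓ AddSubgroup.torsionBy W.galH1 (p : ℤ) : AddSubgroup W.galH1) = ⊥)
    (Dt : ModularParametrizationData W (W.conductorNorm ℤ)) (hc : ¬ ((p : ℤ) ∣ Dt.c))
    (β : ℤ) (hβ : (4 * (W.conductorNorm ℤ : ℤ)) ∣ β ^ 2 - NumberField.discr K) (ι : K →+* ℂ)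
    [∀ k : ℕ, NumberField (ringClassField K ι k)] :
    ∃ (ℓ : ℕ) (d : KolyvaginHeegnerData Dt β ι ℓ),
      ℓ.Prime ∧ Zhang2014.IsKolyvaginPrime (W.conductorNorm ℤ) W K p ℓ ∧
        d.kolyvaginClass hp.out 1 ≠ 0 ∧
        ∀ d₀ : KolyvaginHeegnerData Dt β ι 1, d₀.kolyvaginClass hp.out 1 = 0 := by
  have htam : ¬ p ∣ W.tamagawaProduct := not_dvd_tamagawaProduct_of_kodairaNeron W p h5 hKN
  obtain ⟨n, d, hsupp, hne, hmin, hdich⟩ :=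
    exists_minimal_kolyvaginClass_one_selmerCard_of_castellaSano h3 hZ hHZ W p h5 hgood hord hsurj
      htower htam K hK hHeeg hodd hD3 hD4 hDN hpD hspl Dt hc β hβ ι
  have hpP : p.Prime := hp.out
  have h2p : 2 ≤ p := hpP.two_le
  haveI : NeZero (p : ℚ) := ⟨by exact_mod_cast hpP.ne_zero⟩
  have hirr : W.HasIrreducibleModPGaloisRep p :=
    hasIrreducibleModPGaloisRep_of_hasSurjectiveModNGaloisRep W p hsurj
  have hdK : (NumberField.discr K : ℚ) ≠ 0 := by exact_mod_cast NumberField.discr_ne_zero K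
  haveI := W.isElliptic_quadraticTwist hdK
  have hirrT : (W.quadraticTwist (NumberField.discr K : ℚ)).HasIrreducibleModPGaloisRep p :=
    (W.hasIrreducibleModPGaloisRep_quadraticTwist_iff hdK p).mpr hirr
  have hSelW : Nat.card (W.selmerGroup p) = p ^ 2 := by
    rw [← hr]; exact natCard_selmerGroup_eq_pow_rank_of_sha_inf_torsionBy_eq_bot W p hirr hshaW
  have hSelT : Nat.card ((W.quadraticTwist (NumberField.discr K : ℚ)).selmerGroup p) =
      p ^ (W.quadraticTwist (NumberField.discr K : ℚ)).mordellWeilRank :=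
    natCard_selmerGroup_eq_pow_rank_of_sha_inf_torsionBy_eq_bot _ p hirrT hshaT
  have hν : n.primeFactors.card = 1 := by
    rcases hdich with ⟨hW1, -⟩ | ⟨hT1', hW2⟩
    · rw [hSelW] at hW1
      have := Nat.pow_right_injective h2p hW1
      omega
    · exfalso
      rw [hSelT] at hT1'
      have h1 := Nat.pow_right_injective h2p hT1'
      have h0 : n.primeFactors.card = 0 := by omega
      rw [hSelW, h0, pow_zero] at hW2
      have : 2 ^ 2 ≤ p ^ 2 := Nat.pow_le_pow_left h2p 2
      omega
  have hn : n.Prime := prime_of_squarefree_of_card_primeFactors_eq_one₉ hsupp.1 hν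
  have hmem : n ∈ n.primeFactors := by
    rw [hn.primeFactors]; exact Finset.mem_singleton_self n
  refine ⟨n, d, hn, hsupp.2 n hmem, hne, fun d₀ ↦ ?_⟩
  by_contra h0
  have := hmin 1 d₀ (KolyvaginDescent.kolSupp_one _) h0
  rw [hν, Nat.primeFactors_one, Finset.card_empty] at this
  omega

/-- **THE RANK-2 SLICE AT LEVEL ONE ON THE WHOLE KODAIRA–NÉRON CELL, per `(E, p, K)` (modulo (γ) and
six print facts by name).** `E/ℚ` non-CM globally minimal of Mordell–Weil rank `2`; `p ≥ 5` good ordinary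
with `ρ_{E,p^n}` onto for all `n` and `p ∤ ord_v(Δ_min)` at multiplicative places (NO Hypothesis ♠ (2),
NO square-free `N`); `K` imaginary quadratic Heegner with `d_K` odd, `≠ −3, −4`, `p ∤ d_K`, `p` split in
`K`, `(d_K, N) = 1`; twist side pinned (`rank E^{(d_K)} ≤ 1`, `Ш(E^{(d_K)})[p] = 0`). THEN: «some frame,
some Kolyvagin prime `ℓ`, some datum of conductor `ℓ` with `c_1(ℓ) ≠ 0`» `↔` «`Ш(E/ℚ)[p] = 0`». `→`: the
KN door of a datum ((γ) = `GrossLMS1991.prop37_2_frobeniusCongruence` only); `←`: the supply on the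
frame with `p ∤ c` (modularity + Mazur 1978 Cor. 4.1 + Néron scaling give the frame; Castella–Sano +
Zanarella + Howard–Zanarella give the class). The depth-table bit at every rank-2 row of the cell —
`664a1`, `916c1`, `944e1` included — is exactly «`Ш(E)[p] = 0`». CONDITIONAL on the named facts; per
curve; BSD is not proved by it. [cite: GrossLMS1991, Prop. 3.7 (2)] [cite: CastellaSano2026, Thm. 3]
[cite: Zanarella2019, Prop. 2.18, Cor. 2.14] [cite: Howard2004, Lemma 1.6.4] [cite: Mazur1978, Cor. 4.1]
[cite: Kolyvagin1991MathAnn, Thm. 2.3] [cite: JetchevLauterStein2009, §3.6] -/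
theorem kolyvaginClass_one_prime_ne_zero_iff_sha_trivial_of_rank_two_of_maninPrint
    (h372 : GrossLMS1991.prop37_2_frobeniusCongruence)
    (h3 : Literature.NumberTheory.EllipticCurves.CastellaSano2026_kolyvaginClass_selmerDivisibility_eq_padicValNat_tamagawaProduct)
    (hZ : Literature.NumberTheory.EllipticCurves.Zanarella2019_kolyvaginClass_one_ne_zero_of_not_selmerDivisible)
    (hHZ : Literature.NumberTheory.EllipticCurves.HowardZanarella_exists_minimal_kolyvaginClass_one_selmerCard_of_ne_zero)
    (hnf : exists_isNewformOf) (hMaz : mazur_not_dvd_maninConstant_of_odd)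
    (hNS : integral_neronScaling_of_isGloballyMinimal)
    (W : WeierstrassCurve ℚ) [W.IsElliptic] [W.IsGloballyMinimal] (hcm : ¬ W.HasCM)
    (hr : W.mordellWeilRank = 2)
    (p : ℕ) [hp : Fact p.Prime] (h5 : 5 ≤ p) (hgood : W.HasGoodReductionAtPrime p)
    (hord : ¬ (p : ℤ) ∣ W.frobeniusTrace p)
    (htower : ∀ n : ℕ, W.HasSurjectiveModNGaloisRep (p ^ n : ℕ))
    (hKN : ∀ v : HeightOneSpectrum (𝓞 ℚ), W.HasMultiplicativeReductionAt v →
      ¬ p ∣ W.ordMinimalDiscriminant v)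
    (K : Type) [Field K] [NumberField K] (hK : IsImaginaryQuadratic K)
    (hodd : Odd (NumberField.discr K)) (hD3 : NumberField.discr K ≠ -3) (hD4 : NumberField.discr K ≠ -4)
    (hpD : ¬ ((p : ℤ) ∣ NumberField.discr K)) (hspl : SatisfiesHeegnerHypothesis p K)
    (hDN : IsCoprime (NumberField.discr K) ((W.conductorNorm ℤ : ℕ) : ℤ))
    [NeZero (W.conductorNorm ℤ)] (hH : SatisfiesHeegnerHypothesis (W.conductorNorm ℤ) K)
    (hT1 : (W.quadraticTwist (NumberField.discr K : ℚ)).mordellWeilRank ≤ 1)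
    (hshaT : ((W.quadraticTwist (NumberField.discr K : ℚ)).sha ⊓
        AddSubgroup.torsionBy (W.quadraticTwist (NumberField.discr K : ℚ)).galH1 (p : ℤ) :
        AddSubgroup (W.quadraticTwist (NumberField.discr K : ℚ)).galH1) = ⊥) :
    (∃ (Dt : ModularParametrizationData W (W.conductorNorm ℤ)) (β : ℤ) (ι : K →+* ℂ) (ℓ : ℕ)
      (d : KolyvaginHeegnerData Dt β ι ℓ),
      ℓ.Prime ∧ Zhang2014.IsKolyvaginPrime (W.conductorNorm ℤ) W K p ℓ ∧
        d.kolyvaginClass hp.out 1 ≠ 0) ↔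
    (W.sha ⊓ AddSubgroup.torsionBy W.galH1 (p : ℤ) : AddSubgroup W.galH1) = ⊥ := by
  have hpP : p.Prime := hp.out
  have hp2 : p ≠ 2 := by omega
  have hsurj : W.HasSurjectiveModNGaloisRep p := by simpa only [pow_one] using htower 1
  constructor
  · -- the door of a datum on the Kodaira–Néron cell, (γ) only
    rintro ⟨Dt, β, ι, ℓ, d, hℓ, hkol, hne⟩
    obtain ⟨c, hc, hcc⟩ := exists_conj_of_isImaginaryQuadratic K hK
    have hadd : ∀ v : HeightOneSpectrum (𝓞 ℚ), W.HasAdditiveReductionAt v → p ≠ 3 ∨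
        (W.kodairaSymbolAt v ≠ KodairaSymbol.IV ∧ W.kodairaSymbolAt v ≠ KodairaSymbol.IVstar) :=
      fun _ _ ↦ Or.inl (by omega)
    have hk : ∀ q ∈ ℓ.primeFactors, Zhang2014.IsKolyvaginPrime (W.conductorNorm ℤ) W K p q := by
      intro q hq
      rw [hℓ.primeFactors, Finset.mem_singleton] at hq
      exact hq ▸ hkol
    have hrank : ℓ.primeFactors.card + 1 ≤ W.mordellWeilRank := by
      rw [hℓ.primeFactors, Finset.card_singleton, hr]
    obtain ⟨-, -, -, -, hbot, -⟩ :=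
      shaCorank_eq_zero_of_kolyvaginClass_ne_zero_of_rank_le_of_datum_kodairaNeron h372 hcm hK hD3 hD4
        hH p hp2 htower c hc hcc hKN hadd hℓ.squarefree hk d hne hrank
    simpa only [pow_one] using hbot
  · -- the supply on the frame with `p ∤ c` (Mazur + Néron scaling), Castella–Sano ∘ Zanarella ∘ Howard–Zanarella
    intro hshaW
    have hpN : ¬ p ^ 2 ∣ W.conductorNorm ℤ := fun h ↦
      not_dvd_conductorNorm_of_hasGoodReductionAtPrime W hgood (dvd_trans (dvd_pow_self p two_ne_zero) h)
    have hirr : W.HasIrreducibleModPGaloisRep p :=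
      hasIrreducibleModPGaloisRep_of_hasSurjectiveModNGaloisRep W p hsurj
    obtain ⟨Dt, hcD⟩ :=
      Summit.BirchSwinnertonDyer.Rank1Residual.X11b.exists_modularParametrizationData_not_dvd hnf hMaz hNS
        W rfl hpP hp2 hpN hirr
    obtain ⟨β, hβ⟩ := exists_dvd_sq_sub_discr_holds (W.conductorNorm ℤ) K hK hH
    obtain ⟨ι⟩ : Nonempty (K →+* ℂ) := inferInstance
    haveI : ∀ k : ℕ, NumberField (ringClassField K ι k) := fun k ↦
      Summit.BirchSwinnertonDyer.Rank1Residual.JET.numberField_ringClassField K hK ι k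
    obtain ⟨ℓ, d, hℓ, hkol, hne, -⟩ :=
      exists_kolyvaginClass_one_prime_ne_zero_of_rank_two_of_sha_trivial_of_castellaSano h3 hZ hHZ W hr p
        h5 hgood hord hsurj htower hKN K hK hodd hD3 hD4 hpD hspl hDN hH hT1 hshaT hshaW Dt hcD β hβ ι
    exact ⟨Dt, β, ι, ℓ, d, hℓ, hkol, hne⟩

end Summit.BirchSwinnertonDyer.BirchSwinnertonDyer.Theorems.KolyvaginDepthDoor

end
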